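import Summits.Ventures.CertifiedManyBodySolver.Certificates.SymRungV0core.Cert
import Summits.Ventures.CertifiedManyBodySolver.Statement

/-!
# The rung «V0CORE» (v0′, rung V) as an M3 lower energy ROW (stmt-Ventures-22024 vocabulary)

`Summit.Ventures.CertifiedManyBodySolver.M3EnergyLowerRow 0 lo` (Statement.lean) is the predicate the crux
`Theses.M3x2EdgeSplit.LowerEdge_ge_m83o100 = ∃ lo, −83/100 ≤ lo ∧ M3EnergyLowerRow 0 lo` quantifies over.  The kernel-replayed
symmetry-reduced R-certificate `Certificates.SymRungV0core.cert` (team lb-sym: checker by hub-lb-sym-plan-1 / hub-lb-sym-eng-3,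
certificate by hub-lb-sym-eng-1 g1, comparator hub-lb-sym-ref-2, Lean legs hub-lb-sym-ref-1, lander hub-lb-sym-eng-4 g1) gives an
UNCONDITIONAL inhabitant of that predicate at `lo = −270273895186422731696475/2⁷⁸ ≈ −0.8942613` — 0.064 short of the crux's `−83/100`,
so this is a rung, not the edge: it supports the item without closing it (it improves the W3BOX rung `…LowerRowW3Box`, `−1.0238`).
Computational grade: the proof term depends on the `native_decide` evaluations of the certificate modules.
No summit statement is proved here; nothing here predicts superconductivity.
-/

namespace Summit.Ventures.CertifiedManyBodySolver.Theorems

open Literature.MathematicalPhysics.QuantumLattice.ThermodynamicLimit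

/-- **M3 lower row at `t' = 0` from the replayed v0′ certificate**: `e₀(t=1, t'=0, U=8, n=7/8) ≥ −270273895186422731696475/2⁷⁸`
(`≈ −0.8942613`), unconditionally (computational grade); a re-export of `Certificates.SymRungV0core.m3_tp0_lowerRow_v0core`. -/
theorem m3_tp0_lowerRow_v0core_row :
    M3EnergyLowerRow 0 ((-270273895186422731696475 : ℚ) / 302231454903657293676544) :=
  Certificates.SymRungV0core.m3_tp0_lowerRow_v0core

/-- The same row in the `∃`-shape of the crux, with the rung's (insufficient) constant: `∃ lo ≥ −0.8943` such that the row holds —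
recorded to make the remaining gap to `LowerEdge_ge_m83o100` (`−83/100 ≤ lo`) explicit: 0.0643. -/
theorem exists_m3_tp0_lowerRow_ge_m0p8943 :
    ∃ lo : ℚ, (-0.8943 : ℚ) ≤ lo ∧ M3EnergyLowerRow 0 lo :=
  ⟨(-270273895186422731696475 : ℚ) / 302231454903657293676544, by norm_num, m3_tp0_lowerRow_v0core_row⟩

end Summit.Ventures.CertifiedManyBodySolver.Theorems
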